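import Literature.Computability.AlgebraicComplexity.BorderRankCWKoszulPowerQ2Proofs
import HarnessLib

/-!
# Border rank of Kronecker powers of `T_{cw,2}`: the certified `902` read at full strength

`Summits/MatrixMultiplication/MatrixMultiplication/Theorems` (soloist file, blind arm).

The tree certifies (LU certificates mod `11`, `xyzCube_koszulRank_ge`) that the torus-weight
restricted `p = 3` Koszul flattening of the cube of the `xyz`-tensor `X ≅ T_{cw,2}` has rank `≥ 902`,
and uses it only through `900 = 45 · C(6,3)` to obtain the printed bound
`bR(T_{cw,2}^{⊠N}) ≥ 15 · 3^{N-2}` (Conner–Gesmundo–Landsberg–Ventura 2022, Thm. 1.2 (iii), `q = 2`).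
Read at full strength, the same certificate and the same propagation (CGLV Prop. 3.2 / 4.1 with the
`1_A`-generic factor `X^{⊠(N-3)}`) give

* `soloKos_cwTwo_pow_twenty_mul_algBorderRank_ge` — `902 · 3^{N-3} ≤ 20 · bR(T_{cw,2}^{⊠N})` for `N ≥ 3`;
* `soloKos_cwTwo_cube_algBorderRank_ge_46` — **`bR(T_{cw,2}^{⊠3}) ≥ 46`** (printed: `45`);
* `soloKos_cwTwo_pow_algBorderRank_ge` — `bR(T_{cw,2}^{⊠N}) ≥ ⌈902 · 3^{N-3} / 20⌉` for `N ≥ 3`, e.g.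
  `bR(T_{cw,2}^{⊠4}) ≥ 136`, `bR(T_{cw,2}^{⊠6}) ≥ 1218`, `bR(T_{cw,2}^{⊠7}) ≥ 3654` (printed:
  `135, 1215, 3645`).

Context (not formalised): modular-rank computations of the generic `(q,p) = (7,3), (9,4), (11,5)`
flattenings of the cube (`924, 3318, 12144`) and of the `(9,4)` flattening of the fourth power (`10122`)
indicate `bR(T_{cw,2}^{⊠3}) ≥ 49` and `bR(T_{cw,2}^{⊠4}) ≥ 145`; only the tree's certificate `902` is
used here.

References: A. Conner, F. Gesmundo, J.M. Landsberg, E. Ventura, *Rank and border rank of Kronecker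
powers of tensors and Strassen's laser method*, comput. complexity 31 (2022), Thm. 1.2, Prop. 3.2;
J.M. Landsberg, G. Ottaviani, *Equations for secant varieties of Veronese and other varieties* (2013)
(Koszul flattenings).
-/

noncomputable section

open scoped BigOperators
open Matrix

namespace Summit.MatrixMultiplication.MatrixMultiplication.Theorems

open Literature.Computability.AlgebraicComplexity

/-- **`902 · 3^{N-3} ≤ 20 · bR(T_{cw,2}^{⊠N})`** for `N ≥ 3`: the tree's certified rank `902` of the
torus-weight restricted `p = 3` flattening of the `xyz`-cube, propagated by CGLV Prop. 3.2 along the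
`1_A`-generic factor `X^{⊠(N-3)}` and transported to `T_{cw,2} ≥ X` — the assembly of
`le_algBorderRank_kroneckerPow_cwTensor_two_of_rank` with `902` kept in place of `900`. -/
theorem soloKos_cwTwo_pow_twenty_mul_algBorderRank_ge (N : ℕ) (hN : 3 ≤ N) :
    902 * 3 ^ (N - 3) ≤ 20 * algBorderRank (kroneckerPow (cwTensor ℂ 2) N) := by
  obtain ⟨m, rfl⟩ : ∃ m, N = m + 3 := ⟨N - 3, by omega⟩
  have key := rank_koszulFlattening_mul_pow_le_algBorderRank_kroneckerPow (xyzTensor ℂ)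
    isUnit_contractFirst_xyzTensor 3 3 m (m + 3) (by omega) xyzMArrow.mulVecLin
  rw [koszulFlattening_kroneckerPow_three_xyz_bridge, Matrix.rank_submatrix, Fintype.card_fin,
    show Nat.choose (2 * 3) 3 = 20 by decide] at key
  have e : m + 3 - 3 = m := by omega
  rw [e]
  exact ((Nat.mul_le_mul_right (3 ^ m) xyzCube_koszulRank_ge).trans key).trans
    (Nat.mul_le_mul_left 20 (algBorderRank_kroneckerPow_xyz_le (m + 3)))

/-- **`bR(T_{cw,2}^{⊠N}) ≥ ⌈902 · 3^{N-3} / 20⌉`** for `N ≥ 3` (ceiling written as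
`(902 · 3^{N-3} + 19) / 20`). -/
theorem soloKos_cwTwo_pow_algBorderRank_ge (N : ℕ) (hN : 3 ≤ N) :
    (902 * 3 ^ (N - 3) + 19) / 20 ≤ algBorderRank (kroneckerPow (cwTensor ℂ 2) N) := by
  have h := soloKos_cwTwo_pow_twenty_mul_algBorderRank_ge N hN
  omega

/-- **`bR(T_{cw,2}^{⊠3}) ≥ 46`** — one more than the printed `15 · 3 = 45` of CGLV Thm. 1.2 (iii),
from the same certificate (`⌈902/20⌉ = 46`). -/
theorem soloKos_cwTwo_cube_algBorderRank_ge_46 :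
    46 ≤ algBorderRank (kroneckerPow (cwTensor ℂ 2) 3) := by
  have h := soloKos_cwTwo_pow_twenty_mul_algBorderRank_ge 3 le_rfl
  norm_num at h
  omega

/-- **`bR(T_{cw,2}^{⊠4}) ≥ 136`** (printed: `135`). -/
theorem soloKos_cwTwo_pow_four_algBorderRank_ge :
    136 ≤ algBorderRank (kroneckerPow (cwTensor ℂ 2) 4) := by
  have h := soloKos_cwTwo_pow_twenty_mul_algBorderRank_ge 4 (by norm_num)
  norm_num at h
  omega

/-- **`bR(T_{cw,2}^{⊠6}) ≥ 1218`** (printed: `1215`; the exponent-improving threshold at `N = 6` for a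
border identity of `T_{cw,2}^{⊠6}` is `bR < 3.2688^6 ≈ 1219.9`, so at most the two values `1218, 1219`
of `bR(T_{cw,2}^{⊠6})` could still improve `ω` through `T_{cw,2}` at the sixth power). -/
theorem soloKos_cwTwo_pow_six_algBorderRank_ge :
    1218 ≤ algBorderRank (kroneckerPow (cwTensor ℂ 2) 6) := by
  have h := soloKos_cwTwo_pow_twenty_mul_algBorderRank_ge 6 (by norm_num)
  norm_num at h
  omega

/-- **`bR(T_{cw,2}^{⊠7}) ≥ 3654`** (printed: `3645`). -/
theorem soloKos_cwTwo_pow_seven_algBorderRank_ge :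
    3654 ≤ algBorderRank (kroneckerPow (cwTensor ℂ 2) 7) := by
  have h := soloKos_cwTwo_pow_twenty_mul_algBorderRank_ge 7 (by norm_num)
  norm_num at h
  omega

end Summit.MatrixMultiplication.MatrixMultiplication.Theorems

end
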